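import Summits.SmoothPoincare4.SmoothPoincare4.Theses.CylinderEntropy
import Literature.Geometry.Riemannian.SphericalCylinderEntropy
import Literature.Geometry.Riemannian.LowEntropyHypersurfacesFourProofs
import HarnessLib

/-!
# `stub_smallScaleDomination` of line `conformal-kernel-domination` is FALSE without its slab hypothesis
# (modulo the route's calibration item `SliceCalibration`)

Crux `CylinderEntropy.SliceIsolation` (`stmt-SmoothPoincare4-7632`), line `conformal-kernel-domination`, registered stub
`stub_smallScaleDomination`: "for every `δ > 0` there is `t₁ > 0` such that for every measurable `A ⊆ N = S⁴ × ℝ ⊂ ℝ⁶`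
IN THE UNIT SLAB `|s - t₀| ≤ 1`, every centre `y ∈ ℝ⁵` and every scale `0 < t ≤ t₁ e^{2t₀}`, the Euclidean Gaussian
area of the conformal image `Φ(A)` (`Φ(x,s) = eˢ x`) is at most `(1+δ) λ_cyl(A)`".

NEGATIVE (tightness) lemma by the deep-refuter of the line: with the slab hypothesis `∀ z ∈ A, |z 5 - t₀| ≤ 1` deleted the
statement is false — GIVEN the route's support item `SliceCalibration` (`stmt-SmoothPoincare4-7634`, the typed identity
`λ_cyl(S⁴ × {0}) = 1`, open at the time of writing; only its easy consequence "`≤ 1`" is used).  Witness: the slice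
`S⁴ × {0}` itself, seen from `y = 0` at the scale `t = 1/8` matched to the unit sphere `Φ(S⁴ × {0})`, with the free
parameter `t₀ := ½ log (1/(8t₁))` chosen so large that `t₁ e^{2t₀} = 1/8`: the Gaussian area is `λ(S⁴) = 32/(3e²) ≈ 1.4436`
(`gaussianEntropy_sphere_four` + Stone's value in the tree), above `(1 + 1/10)·λ_cyl = 11/10`.  So the slab is what ties
the admissible scales to the position of `A` — load-bearing, as designed (the composition feeds it from `stub_slabConfinement`).
Everything is proved; no facts, no definitions.
-/

noncomputable section

open MeasureTheory Set Metric
open scoped ENNReal Topology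

namespace Summit.SmoothPoincare4.SmoothPoincare4.Theorems.SliceIsolation.Negative

open Literature.Geometry.Riemannian
open Literature.Geometry.Manifold.CylinderSlice
open Literature.Geometry.Riemannian.SphericalCylinderEntropy (cylEntropy measurableSet_range_sliceMap)
open Summit.SmoothPoincare4.SmoothPoincare4.Theses.CylinderEntropy (SliceCalibration)

set_option linter.dupNamespace false



/-- `Φ` maps the slice `S⁴ × {0}` onto the unit sphere about `0`. [folklore] -/
theorem image_conformal_range_sliceMap_zero :
    (fun z : EuclideanSpace ℝ (Fin 6) =>
  (WithLp.toLp 2 (fun i : Fin 5 => Real.exp (z 5) * z (Fin.castSucc i)) : EuclideanSpace ℝ (Fin 5))) '' Set.range (sliceMap 0) = Metric.sphere (0 : EuclideanSpace ℝ (Fin 5)) 1 := by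
  rw [← Set.range_comp]
  have h : ((fun z : EuclideanSpace ℝ (Fin 6) =>
  (WithLp.toLp 2 (fun i : Fin 5 => Real.exp (z 5) * z (Fin.castSucc i)) : EuclideanSpace ℝ (Fin 5))) ∘ sliceMap 0) = ((↑) : (Metric.sphere (0 : EuclideanSpace ℝ (Fin 5)) 1) → EuclideanSpace ℝ (Fin 5)) := by
    funext x
    ext i
    simp [sliceMap_apply_castSucc, sliceMap_apply_last]
  rw [h, Subtype.range_coe]

/-- The unit sphere about `0`, seen from `0` at the matched scale `1/8`, has Gaussian area exactly `λ(S⁴) = 32/(3e²)`.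
[cite: ColdingMinicozzi2012, Lemma 7.10] -/
theorem gaussianArea_unitSphere_matched :
    gaussianArea 4 (0 : EuclideanSpace ℝ (Fin 5)) (1 / 8) (Metric.sphere (0 : EuclideanSpace ℝ (Fin 5)) 1) = ENNReal.ofReal (32 / (3 * Real.exp 1 ^ 2)) := by
  have h8 : (0 : ℝ) < Real.sqrt 8 := Real.sqrt_pos.2 (by norm_num)
  set a : ℝ := (Real.sqrt 8)⁻¹ with ha
  have ha0 : 0 < a := inv_pos.2 h8
  have hV : Module.finrank ℝ (EuclideanSpace ℝ (Fin 5)) = 4 + 1 := by simp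
  have h := gaussianArea_smul ha0.ne' 4 (0 : EuclideanSpace ℝ (Fin 5)) one_pos (Metric.sphere (0 : EuclideanSpace ℝ (Fin 5)) (Real.sqrt (2 * (4 : ℕ))))
  have hs : Real.sqrt (2 * ((4 : ℕ) : ℝ)) = Real.sqrt 8 := by norm_num
  rw [hs, smul_zero, mul_one, smul_sphere' ha0.ne', smul_zero, Real.norm_eq_abs, abs_of_pos ha0] at h
  have h1 : a * Real.sqrt 8 = 1 := by rw [ha, inv_mul_cancel₀ h8.ne']
  have h2 : a ^ 2 = 1 / 8 := by
    rw [ha, inv_pow, Real.sq_sqrt (by norm_num : (0 : ℝ) ≤ 8), one_div]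
  rw [h1, h2] at h
  rw [h, ← hs, gaussianArea_zero_one_shrinkingSphere hV (by norm_num), sphereEntropy_four]

/-- **`stub_smallScaleDomination` without its slab hypothesis is false, given `SliceCalibration`.**  The registered
statement of the stub with `(∀ z ∈ A, |z 5 - t₀| ≤ 1)` removed; witness: `δ = 1/10`, the slice `S⁴ × {0}`, `y = 0`,
`t = 1/8`, `t₀ = ½ log(1/(8t₁))`. [folklore] -/
theorem smallScaleDomination_false_without_slab_of_sliceCalibration (hSC : SliceCalibration) :
    ¬ (∀ δ : ℝ, 0 < δ → ∃ t₁ : ℝ, 0 < t₁ ∧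
        ∀ (t₀ : ℝ) (A : Set (EuclideanSpace ℝ (Fin 6))),
          A ⊆ {z : EuclideanSpace ℝ (Fin 6) | ∑ i : Fin 5, z (Fin.castSucc i) ^ 2 = 1} → MeasurableSet A →
          ∀ (y : EuclideanSpace ℝ (Fin 5)) (t : ℝ), 0 < t → t ≤ t₁ * Real.exp (2 * t₀) →
            gaussianArea 4 y t ((fun z : EuclideanSpace ℝ (Fin 6) =>
                (WithLp.toLp 2 (fun i : Fin 5 => Real.exp (z 5) * z (Fin.castSucc i)) :
                  EuclideanSpace ℝ (Fin 5))) '' A) ≤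
              ENNReal.ofReal (1 + δ) * cylEntropy A) := by
  intro h
  obtain ⟨t₁, ht₁, H⟩ := h (1 / 10) (by norm_num)
  set t₀ : ℝ := Real.log (1 / (8 * t₁)) / 2 with ht₀
  have hexp : t₁ * Real.exp (2 * t₀) = 1 / 8 := by
    rw [ht₀, mul_div_cancel₀ _ (two_ne_zero), Real.exp_log (by positivity)]
    field_simp
  set A : Set (EuclideanSpace ℝ (Fin 6)) := Set.range (sliceMap 0) with hA
  have hAN : A ⊆ {z : EuclideanSpace ℝ (Fin 6) | ∑ i : Fin 5, z (Fin.castSucc i) ^ 2 = 1} := by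
    rintro z ⟨x, rfl⟩
    exact sum_sq_sliceMap _ x
  have hAm : MeasurableSet A := measurableSet_range_sliceMap 0
  have key := H t₀ A hAN hAm 0 (1 / 8) (by norm_num) hexp.symm.le
  -- the slice is calibrated: `λ_cyl(S⁴ × {0}) = 1` is the route item `SliceCalibration` verbatim
  have hcal : cylEntropy A = 1 := by
    rw [hA, range_sliceMap]
    exact hSC
  rw [hA, image_conformal_range_sliceMap_zero, gaussianArea_unitSphere_matched, ← hA, hcal, mul_one,
    ENNReal.ofReal_le_ofReal_iff (by norm_num)] at key
  -- `32/(3e²) ≤ 11/10` is absurd: `e² < 7.39 < 320/33`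
  have h1e : Real.exp 1 < 2.7182818286 := Real.exp_one_lt_d9
  have hpos : 0 < Real.exp 1 := Real.exp_pos 1
  rw [div_le_iff₀ (by positivity)] at key
  nlinarith [key, h1e, hpos]

/-- **The constant of `stub_entropyDomination` cannot be lowered (given `SliceCalibration`).**  For every
`C < λ(unit S⁴)` the domination `λ(Φ A) ≤ C · λ_cyl(A)` fails at the slice `A = S⁴ × {0}` (`Φ A` = unit sphere,
`λ_cyl(A) = 1`): the sharp variant of the line is an equality on slices, so any proof of it must be exact at the
ground state (cf. the refuters' notes: the deficit away from slices is only `Λ₄/(40t)`). [folklore] -/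
theorem entropyDomination_false_of_const_lt_of_sliceCalibration (hSC : SliceCalibration) {C : ℝ≥0∞}
    (hC : C < gaussianEntropy 4 (Metric.sphere (0 : EuclideanSpace ℝ (Fin 5)) 1)) :
    ¬ (∀ A : Set (EuclideanSpace ℝ (Fin 6)),
        A ⊆ {z : EuclideanSpace ℝ (Fin 6) | ∑ i : Fin 5, z (Fin.castSucc i) ^ 2 = 1} → MeasurableSet A →
          gaussianEntropy 4 ((fun z : EuclideanSpace ℝ (Fin 6) =>
              (WithLp.toLp 2 (fun i : Fin 5 => Real.exp (z 5) * z (Fin.castSucc i)) :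
                EuclideanSpace ℝ (Fin 5))) '' A) ≤ C * cylEntropy A) := by
  intro h
  have hAN : Set.range (sliceMap 0) ⊆ {z : EuclideanSpace ℝ (Fin 6) | ∑ i : Fin 5, z (Fin.castSucc i) ^ 2 = 1} := by
    rintro z ⟨x, rfl⟩
    exact sum_sq_sliceMap _ x
  have key := h (Set.range (sliceMap 0)) hAN (measurableSet_range_sliceMap 0)
  have hcal : cylEntropy (Set.range (sliceMap 0)) = 1 := by
    rw [range_sliceMap]
    exact hSC
  rw [image_conformal_range_sliceMap_zero, hcal, mul_one] at key
  exact absurd (hC.trans_le key) (lt_irrefl _)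

end Summit.SmoothPoincare4.SmoothPoincare4.Theorems.SliceIsolation.Negative

end
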